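import Literature.MathematicalPhysics.QuantumLattice.HubbardFermiRadiusBandSmooth
import Mathlib.Analysis.Calculus.IteratedDeriv.Lemmas
import Mathlib.Analysis.SpecialFunctions.Trigonometric.ArctanDeriv
import HarnessLib

/-!
# Strict convexity and the Gauss map of the square-lattice Fermi curve over the whole band

Topic `Literature/MathematicalPhysics/QuantumLattice`; the analogue, for the band Fermi radius
`u = bandFermiRadius μ` at every level `-4 < μ < 0` (`HubbardFermiRadiusBand*.lean`), of
`HubbardFermiCurvature.lean` / `HubbardFermiGaussMap.lean` (which treat the small-filling radius
`fermiRadius`, `μ < -2 - √2`, where `Hess ε ≥ √2` on a box containing the curve). Near half filling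
the curve leaves that box (`cos kᵢ < 0` occurs), but the level curves of `ε(k) = -2(cos k₁ + cos k₂)`
stay strictly convex throughout the band: the curvature numerator is
`cos x·x'² + cos y·y'² = (cos x sin²y + cos y sin²x)/c² = (-μ/2)(1 - cos x cos y)/c² > 0`.

* §1 `bandRadiusDeriv2` (`u''`), the Cartesian parametrisation `bandX/Y`, velocity `bandVX/VY`,
  acceleration `bandAX/AY` and their `HasDerivAt` chain; the tangency identity
  `sin x·x' + sin y·y' = 0` and its derivative `cos x·x'² + sin x·x'' + cos y·y'² + sin y·y'' = 0`;
* §2 the normal form `sin x = c y'`, `sin y = -c x'`, `c = bandNormalCoeff > 0`, and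
  **`0 < cos x·x'² + cos y·y'²`** (`bandHess_pos`);
* §3 the normal angle `bandNormalAngle μ θ = θ - arctan(u'/u)` with `(sin x, sin y) = ρ (cos α, sin α)`,
  `ρ > 0`; `α' > 0` (`hasDerivAt_bandNormalAngle`, `bandNormalAngleDeriv_pos`), so `α` is strictly
  increasing, and `α(θ + π) = α(θ) + π`;
* §4 **parallel normals occur only at `θ` and `θ + jπ`** (`exists_eq_add_int_mul_pi_of_cross_eq_zero`):
  if `sin x(θ) sin y(φ) = sin y(θ) sin x(φ)` then `φ = θ + jπ` for some integer `j`.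

Everything is PROVED; the definitions have bodies. [folklore]
-/

noncomputable section

open Real Set Filter
open scoped Topology ContDiff

namespace Literature.MathematicalPhysics.QuantumLattice

/-! ### §1 Second derivative and the Cartesian parametrisation -/

/-- The second derivative `u''(θ)` of the band Fermi radius. [folklore] -/
def bandRadiusDeriv2 (μ θ : ℝ) : ℝ := deriv (bandFermiRadiusDeriv μ) θ

/-- `x(θ) = u(θ) cos θ`. [folklore] -/
def bandX (μ θ : ℝ) : ℝ := bandFermiRadius μ θ * Real.cos θ

/-- `y(θ) = u(θ) sin θ`. [folklore] -/
def bandY (μ θ : ℝ) : ℝ := bandFermiRadius μ θ * Real.sin θ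

/-- `x'(θ) = u' cos θ - u sin θ`. [folklore] -/
def bandVX (μ θ : ℝ) : ℝ := bandFermiRadiusDeriv μ θ * Real.cos θ - bandFermiRadius μ θ * Real.sin θ

/-- `y'(θ) = u' sin θ + u cos θ`. [folklore] -/
def bandVY (μ θ : ℝ) : ℝ := bandFermiRadiusDeriv μ θ * Real.sin θ + bandFermiRadius μ θ * Real.cos θ

/-- `x''(θ) = u'' cos θ - 2u' sin θ - u cos θ`. [folklore] -/
def bandAX (μ θ : ℝ) : ℝ :=
  bandRadiusDeriv2 μ θ * Real.cos θ - 2 * bandFermiRadiusDeriv μ θ * Real.sin θ - bandFermiRadius μ θ * Real.cos θ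

/-- `y''(θ) = u'' sin θ + 2u' cos θ - u sin θ`. [folklore] -/
def bandAY (μ θ : ℝ) : ℝ :=
  bandRadiusDeriv2 μ θ * Real.sin θ + 2 * bandFermiRadiusDeriv μ θ * Real.cos θ - bandFermiRadius μ θ * Real.sin θ

/-- The normal coefficient `c = ∂_tF(θ,u)/(2u)` (so that `(sin x, sin y) = c (y', -x')`). [folklore] -/
def bandNormalCoeff (μ θ : ℝ) : ℝ :=
  rayDispersionDt θ (bandFermiRadius μ θ) / (2 * bandFermiRadius μ θ)

/-- The normal angle `α(θ) = θ - arctan(u'/u)`. [folklore] -/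
def bandNormalAngle (μ θ : ℝ) : ℝ := θ - Real.arctan (bandFermiRadiusDeriv μ θ / bandFermiRadius μ θ)

/-- `α' = (u² + 2u'² - u u'')/(u² + u'²)`. [folklore] -/
def bandNormalAngleDeriv (μ θ : ℝ) : ℝ :=
  (bandFermiRadius μ θ ^ 2 + 2 * bandFermiRadiusDeriv μ θ ^ 2 - bandFermiRadius μ θ * bandRadiusDeriv2 μ θ) /
    (bandFermiRadius μ θ ^ 2 + bandFermiRadiusDeriv μ θ ^ 2)

section Band

variable {μ : ℝ} (hμ₁ : -4 < μ) (hμ₂ : μ < 0)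
include hμ₁ hμ₂

/-- `u'` is smooth. [folklore] -/
theorem contDiff_bandFermiRadiusDeriv : ContDiff ℝ ∞ (bandFermiRadiusDeriv μ) := by
  have h : ContDiff ℝ ∞ (deriv^[1] (bandFermiRadius μ)) :=
    ContDiff.iterate_deriv 1 (contDiff_bandFermiRadius hμ₁ hμ₂ (μ := μ) (n := ∞))
  have hfun : deriv (bandFermiRadius μ) = bandFermiRadiusDeriv μ := funext (deriv_bandFermiRadius hμ₁ hμ₂)
  rwa [Function.iterate_one, hfun] at h

/-- `u'` has derivative `u''`. [folklore] -/
theorem hasDerivAt_bandFermiRadiusDeriv (θ : ℝ) :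
    HasDerivAt (bandFermiRadiusDeriv μ) (bandRadiusDeriv2 μ θ) θ :=
  ((contDiff_bandFermiRadiusDeriv hμ₁ hμ₂).differentiable (by simp) θ).hasDerivAt

/-- `u''` is continuous. [folklore] -/
theorem continuous_bandRadiusDeriv2 : Continuous (bandRadiusDeriv2 μ) := by
  have h := (contDiff_bandFermiRadiusDeriv hμ₁ hμ₂).continuous_deriv (by simp)
  exact h

/-- The curve lies on the level set: `-2(cos x + cos y) = μ`. [folklore] -/
theorem sqDispersion_bandXY (θ : ℝ) : -2 * (Real.cos (bandX μ θ) + Real.cos (bandY μ θ)) = μ := by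
  have h := sqDispersion_bandFermiRadius hμ₁ hμ₂ θ
  simpa [sqDispersion, bandX, bandY, dir] using h

/-- `x` has derivative `x'`. [folklore] -/
theorem hasDerivAt_bandX (θ : ℝ) : HasDerivAt (bandX μ) (bandVX μ θ) θ := by
  have h := (hasDerivAt_bandFermiRadius hμ₁ hμ₂ θ).mul (Real.hasDerivAt_cos θ)
  refine h.congr_deriv ?_
  unfold bandVX; ring

/-- `y` has derivative `y'`. [folklore] -/
theorem hasDerivAt_bandY (θ : ℝ) : HasDerivAt (bandY μ) (bandVY μ θ) θ := by
  have h := (hasDerivAt_bandFermiRadius hμ₁ hμ₂ θ).mul (Real.hasDerivAt_sin θ)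
  refine h.congr_deriv ?_
  unfold bandVY; ring

/-- `x'` has derivative `x''`. [folklore] -/
theorem hasDerivAt_bandVX (θ : ℝ) : HasDerivAt (bandVX μ) (bandAX μ θ) θ := by
  have h := ((hasDerivAt_bandFermiRadiusDeriv hμ₁ hμ₂ θ).mul (Real.hasDerivAt_cos θ)).sub
    ((hasDerivAt_bandFermiRadius hμ₁ hμ₂ θ).mul (Real.hasDerivAt_sin θ))
  refine h.congr_deriv ?_
  unfold bandAX; ring

/-- `y'` has derivative `y''`. [folklore] -/
theorem hasDerivAt_bandVY (θ : ℝ) : HasDerivAt (bandVY μ) (bandAY μ θ) θ := by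
  have h := ((hasDerivAt_bandFermiRadiusDeriv hμ₁ hμ₂ θ).mul (Real.hasDerivAt_sin θ)).add
    ((hasDerivAt_bandFermiRadius hμ₁ hμ₂ θ).mul (Real.hasDerivAt_cos θ))
  refine h.congr_deriv ?_
  unfold bandAY; ring

omit hμ₁ hμ₂ in
/-- `(y', -x')·(x, y) = u²`. [folklore] -/
theorem bandVY_mul_bandX_sub (μ θ : ℝ) :
    bandVY μ θ * bandX μ θ - bandVX μ θ * bandY μ θ = bandFermiRadius μ θ ^ 2 := by
  have hsc := Real.sin_sq_add_cos_sq θ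
  simp only [bandVX, bandVY, bandX, bandY]
  nlinarith [hsc]

/-- **Tangency** `sin x · x' + sin y · y' = 0`. [folklore] -/
theorem sin_mul_bandVX_add (θ : ℝ) :
    Real.sin (bandX μ θ) * bandVX μ θ + Real.sin (bandY μ θ) * bandVY μ θ = 0 := by
  have h1 : HasDerivAt (fun ϑ => -2 * (Real.cos (bandX μ ϑ) + Real.cos (bandY μ ϑ)))
      (-2 * (-Real.sin (bandX μ θ) * bandVX μ θ + -Real.sin (bandY μ θ) * bandVY μ θ)) θ :=
    ((hasDerivAt_bandX hμ₁ hμ₂ θ).cos.add (hasDerivAt_bandY hμ₁ hμ₂ θ).cos).const_mul (-2)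
  have h2 : HasDerivAt (fun ϑ => -2 * (Real.cos (bandX μ ϑ) + Real.cos (bandY μ ϑ))) 0 θ := by
    have : (fun ϑ => -2 * (Real.cos (bandX μ ϑ) + Real.cos (bandY μ ϑ))) = fun _ => μ :=
      funext (sqDispersion_bandXY hμ₁ hμ₂)
    rw [this]; exact hasDerivAt_const θ μ
  have := h1.unique h2
  linarith

/-- **Second-order identity** `cos x · x'² + sin x · x'' + cos y · y'² + sin y · y'' = 0`. [folklore] -/
theorem bandHess_add_grad_dot_acc (θ : ℝ) :
    Real.cos (bandX μ θ) * bandVX μ θ ^ 2 + Real.sin (bandX μ θ) * bandAX μ θ +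
      (Real.cos (bandY μ θ) * bandVY μ θ ^ 2 + Real.sin (bandY μ θ) * bandAY μ θ) = 0 := by
  have h1 : HasDerivAt (fun ϑ => Real.sin (bandX μ ϑ) * bandVX μ ϑ + Real.sin (bandY μ ϑ) * bandVY μ ϑ)
      ((Real.cos (bandX μ θ) * bandVX μ θ) * bandVX μ θ + Real.sin (bandX μ θ) * bandAX μ θ +
        ((Real.cos (bandY μ θ) * bandVY μ θ) * bandVY μ θ + Real.sin (bandY μ θ) * bandAY μ θ)) θ :=
    ((hasDerivAt_bandX hμ₁ hμ₂ θ).sin.mul (hasDerivAt_bandVX hμ₁ hμ₂ θ)).add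
      ((hasDerivAt_bandY hμ₁ hμ₂ θ).sin.mul (hasDerivAt_bandVY hμ₁ hμ₂ θ))
  have h2 : HasDerivAt (fun ϑ => Real.sin (bandX μ ϑ) * bandVX μ ϑ + Real.sin (bandY μ ϑ) * bandVY μ ϑ) 0 θ := by
    have : (fun ϑ => Real.sin (bandX μ ϑ) * bandVX μ ϑ + Real.sin (bandY μ ϑ) * bandVY μ ϑ) = fun _ => 0 :=
      funext (sin_mul_bandVX_add hμ₁ hμ₂)
    rw [this]; exact hasDerivAt_const θ (0 : ℝ)
  have := h1.unique h2
  nlinarith [this]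

/-! ### §2 Normal form of the gradient and strict convexity -/

/-- `c > 0`. [folklore] -/
theorem bandNormalCoeff_pos (θ : ℝ) : 0 < bandNormalCoeff μ θ :=
  div_pos (rayDispersionDt_bandFermiRadius_pos hμ₁ hμ₂ θ) (by have := bandFermiRadius_pos hμ₁ hμ₂ θ; positivity)

/-- **Normal form**: `sin x = c y'`. [folklore] -/
theorem sin_bandX_eq (θ : ℝ) : Real.sin (bandX μ θ) = bandNormalCoeff μ θ * bandVY μ θ := by
  have hT := sin_mul_bandVX_add hμ₁ hμ₂ θ
  have hR : bandX μ θ * Real.sin (bandX μ θ) + bandY μ θ * Real.sin (bandY μ θ) =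
      bandFermiRadius μ θ * rayDispersionDt θ (bandFermiRadius μ θ) / 2 := by
    simp only [bandX, bandY, rayDispersionDt]; ring
  have hrot := bandVY_mul_bandX_sub μ θ
  have hu := bandFermiRadius_pos hμ₁ hμ₂ θ
  have e1 : Real.sin (bandX μ θ) * bandFermiRadius μ θ ^ 2 =
      bandFermiRadius μ θ * rayDispersionDt θ (bandFermiRadius μ θ) / 2 * bandVY μ θ := by
    rw [← hrot]
    linear_combination (-bandY μ θ) * hT + (bandVY μ θ) * hR
  rw [bandNormalCoeff, div_mul_eq_mul_div, eq_div_iff (by positivity)]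
  nlinarith [e1]

/-- **Normal form**: `sin y = -c x'`. [folklore] -/
theorem sin_bandY_eq (θ : ℝ) : Real.sin (bandY μ θ) = -(bandNormalCoeff μ θ * bandVX μ θ) := by
  have hT := sin_mul_bandVX_add hμ₁ hμ₂ θ
  have hR : bandX μ θ * Real.sin (bandX μ θ) + bandY μ θ * Real.sin (bandY μ θ) =
      bandFermiRadius μ θ * rayDispersionDt θ (bandFermiRadius μ θ) / 2 := by
    simp only [bandX, bandY, rayDispersionDt]; ring
  have hrot := bandVY_mul_bandX_sub μ θ
  have hu := bandFermiRadius_pos hμ₁ hμ₂ θ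
  have e2 : Real.sin (bandY μ θ) * bandFermiRadius μ θ ^ 2 =
      -(bandFermiRadius μ θ * rayDispersionDt θ (bandFermiRadius μ θ) / 2 * bandVX μ θ) := by
    rw [← hrot]
    linear_combination (bandX μ θ) * hT + (-bandVX μ θ) * hR
  rw [bandNormalCoeff, div_mul_eq_mul_div, ← neg_div, eq_div_iff (by positivity)]
  nlinarith [e2]

omit hμ₁ hμ₂ in
/-- `cos a cos b < 1` unless `cos a + cos b = ±2`; on a level `cos x + cos y = m ∈ (0, 2)` this gives
`0 < 1 - cos x cos y`. [folklore] -/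
theorem one_sub_cos_mul_cos_pos {a b m : ℝ} (hm0 : 0 < m) (hm2 : m < 2) (h : Real.cos a + Real.cos b = m) :
    0 < 1 - Real.cos a * Real.cos b := by
  have ha1 := Real.cos_le_one a; have ha2 := Real.neg_one_le_cos a
  have hb1 := Real.cos_le_one b; have hb2 := Real.neg_one_le_cos b
  by_contra hle
  push Not at hle
  -- `cos a cos b ≥ 1` forces `|cos a| = |cos b| = 1` with equal signs
  have hprod : 1 ≤ Real.cos a * Real.cos b := by linarith
  rcases le_or_gt 0 (Real.cos a) with hca | hca
  · have hcb : Real.cos b = 1 := by nlinarith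
    have hca' : Real.cos a = 1 := by nlinarith
    rw [hca', hcb] at h; linarith
  · have hcb : Real.cos b = -1 := by nlinarith
    have hca' : Real.cos a = -1 := by nlinarith
    rw [hca', hcb] at h; linarith

/-- **Strict convexity of the band level curves**: `0 < cos x · x'² + cos y · y'²`
(`= (cos x sin² y + cos y sin² x)/c² = (-μ/2)(1 - cos x cos y)/c²`). [folklore] -/
theorem bandHess_pos (θ : ℝ) :
    0 < Real.cos (bandX μ θ) * bandVX μ θ ^ 2 + Real.cos (bandY μ θ) * bandVY μ θ ^ 2 := by
  have hc := bandNormalCoeff_pos hμ₁ hμ₂ θ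
  have hsx := sin_bandX_eq hμ₁ hμ₂ θ
  have hsy := sin_bandY_eq hμ₁ hμ₂ θ
  have hlevel : Real.cos (bandX μ θ) + Real.cos (bandY μ θ) = -μ / 2 := by
    have h := sqDispersion_bandXY hμ₁ hμ₂ θ; linarith
  have hpos := one_sub_cos_mul_cos_pos (by linarith) (by linarith) hlevel
  -- `c² (cos x x'² + cos y y'²) = cos x sin²y + cos y sin²x = (cos x + cos y)(1 - cos x cos y)`
  have key : bandNormalCoeff μ θ ^ 2 * (Real.cos (bandX μ θ) * bandVX μ θ ^ 2 + Real.cos (bandY μ θ) * bandVY μ θ ^ 2) =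
      (Real.cos (bandX μ θ) + Real.cos (bandY μ θ)) * (1 - Real.cos (bandX μ θ) * Real.cos (bandY μ θ)) := by
    have ex := Real.sin_sq_add_cos_sq (bandX μ θ)
    have ey := Real.sin_sq_add_cos_sq (bandY μ θ)
    have h1 : (bandNormalCoeff μ θ * bandVX μ θ) ^ 2 = Real.sin (bandY μ θ) ^ 2 := by rw [hsy]; ring
    have h2 : (bandNormalCoeff μ θ * bandVY μ θ) ^ 2 = Real.sin (bandX μ θ) ^ 2 := by rw [hsx]
    nlinarith [h1, h2, ex, ey]
  have hprod : 0 < (Real.cos (bandX μ θ) + Real.cos (bandY μ θ)) * (1 - Real.cos (bandX μ θ) * Real.cos (bandY μ θ)) := by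
    rw [hlevel]; exact mul_pos (by linarith) hpos
  rw [← key] at hprod
  exact pos_of_mul_pos_right hprod (sq_nonneg _) |> fun h => by
    rcases (mul_pos_iff.1 hprod) with ⟨_, h2⟩ | ⟨h1, _⟩
    · exact h2
    · exact absurd h1 (not_lt.2 (sq_nonneg _))

/-! ### §3 The normal angle -/

/-- `(sin x, sin y) = ρ (cos α, sin α)` with `ρ = c √(u² + u'²) > 0`: the gradient direction is the
normal angle. [folklore] -/
theorem sin_bandXY_eq_polar (θ : ℝ) :
    ∃ ρ : ℝ, 0 < ρ ∧ Real.sin (bandX μ θ) = ρ * Real.cos (bandNormalAngle μ θ) ∧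
      Real.sin (bandY μ θ) = ρ * Real.sin (bandNormalAngle μ θ) := by
  have hu := bandFermiRadius_pos hμ₁ hμ₂ θ
  have hc := bandNormalCoeff_pos hμ₁ hμ₂ θ
  set q : ℝ := bandFermiRadiusDeriv μ θ / bandFermiRadius μ θ with hq
  have hsq : 0 < Real.sqrt (1 + q ^ 2) := Real.sqrt_pos.2 (by positivity)
  refine ⟨bandNormalCoeff μ θ * (bandFermiRadius μ θ * Real.sqrt (1 + q ^ 2)), by positivity, ?_, ?_⟩
  · rw [sin_bandX_eq hμ₁ hμ₂, bandNormalAngle, ← hq, Real.cos_sub, Real.cos_arctan, Real.sin_arctan]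
    simp only [bandVY]
    have hq' : bandFermiRadiusDeriv μ θ = q * bandFermiRadius μ θ := by rw [hq]; field_simp
    rw [hq']
    field_simp
    ring
  · rw [sin_bandY_eq hμ₁ hμ₂, bandNormalAngle, ← hq, Real.sin_sub, Real.cos_arctan, Real.sin_arctan]
    simp only [bandVX]
    have hq' : bandFermiRadiusDeriv μ θ = q * bandFermiRadius μ θ := by rw [hq]; field_simp
    rw [hq']
    field_simp
    ring

omit hμ₁ hμ₂ in
/-- The polar identity `x'y'' - y'x'' = u² + 2u'² - u u''`. [folklore] -/
theorem bandCross_eq_polar (μ θ : ℝ) :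
    bandVX μ θ * bandAY μ θ - bandVY μ θ * bandAX μ θ =
      bandFermiRadius μ θ ^ 2 + 2 * bandFermiRadiusDeriv μ θ ^ 2 - bandFermiRadius μ θ * bandRadiusDeriv2 μ θ := by
  have hsc := Real.sin_sq_add_cos_sq θ
  simp only [bandVX, bandVY, bandAX, bandAY]
  linear_combination (2 * bandFermiRadiusDeriv μ θ ^ 2 + bandFermiRadius μ θ ^ 2 -
    bandFermiRadius μ θ * bandRadiusDeriv2 μ θ) * hsc

/-- The level-set formula `c (x'y'' - y'x'') = cos x x'² + cos y y'²`, hence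
`x'y'' - y'x'' > 0`. [folklore] -/
theorem bandCross_pos (θ : ℝ) : 0 < bandVX μ θ * bandAY μ θ - bandVY μ θ * bandAX μ θ := by
  have hE := bandHess_add_grad_dot_acc hμ₁ hμ₂ θ
  rw [sin_bandX_eq hμ₁ hμ₂, sin_bandY_eq hμ₁ hμ₂] at hE
  have key : bandNormalCoeff μ θ * (bandVX μ θ * bandAY μ θ - bandVY μ θ * bandAX μ θ) =
      Real.cos (bandX μ θ) * bandVX μ θ ^ 2 + Real.cos (bandY μ θ) * bandVY μ θ ^ 2 := by
    linear_combination -hE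
  have hpos := bandHess_pos hμ₁ hμ₂ θ
  rw [← key] at hpos
  exact pos_of_mul_pos_right hpos (bandNormalCoeff_pos hμ₁ hμ₂ θ).le

/-- **`α` is differentiable with `α' = (u² + 2u'² - u u'')/(u² + u'²)`.** [folklore] -/
theorem hasDerivAt_bandNormalAngle (θ : ℝ) : HasDerivAt (bandNormalAngle μ) (bandNormalAngleDeriv μ θ) θ := by
  have hu := bandFermiRadius_pos hμ₁ hμ₂ θ
  have hq : HasDerivAt (fun ϑ => bandFermiRadiusDeriv μ ϑ / bandFermiRadius μ ϑ)
      ((bandRadiusDeriv2 μ θ * bandFermiRadius μ θ - bandFermiRadiusDeriv μ θ * bandFermiRadiusDeriv μ θ) /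
        bandFermiRadius μ θ ^ 2) θ :=
    (hasDerivAt_bandFermiRadiusDeriv hμ₁ hμ₂ θ).div (hasDerivAt_bandFermiRadius hμ₁ hμ₂ θ) hu.ne'
  have h := (hasDerivAt_id θ).sub hq.arctan
  refine h.congr_deriv ?_
  rw [bandNormalAngleDeriv]
  have hs2 : bandFermiRadius μ θ ^ 2 + bandFermiRadiusDeriv μ θ ^ 2 ≠ 0 := by positivity
  field_simp
  ring

/-- `α' > 0`. [folklore] -/
theorem bandNormalAngleDeriv_pos (θ : ℝ) : 0 < bandNormalAngleDeriv μ θ := by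
  have hu := bandFermiRadius_pos hμ₁ hμ₂ θ
  rw [bandNormalAngleDeriv, ← bandCross_eq_polar]
  exact div_pos (bandCross_pos hμ₁ hμ₂ θ) (by positivity)

/-- **`α` is strictly increasing.** [folklore] -/
theorem strictMono_bandNormalAngle : StrictMono (bandNormalAngle μ) :=
  strictMono_of_deriv_pos fun θ => by
    rw [(hasDerivAt_bandNormalAngle hμ₁ hμ₂ θ).deriv]; exact bandNormalAngleDeriv_pos hμ₁ hμ₂ θ

/-- `u'(θ + π) = u'(θ)`. [folklore] -/
theorem bandFermiRadiusDeriv_add_pi (θ : ℝ) : bandFermiRadiusDeriv μ (θ + π) = bandFermiRadiusDeriv μ θ := by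
  have hfun : (fun ϑ => bandFermiRadius μ (ϑ + π)) = bandFermiRadius μ :=
    funext fun ϑ => bandFermiRadius_add_pi hμ₁ hμ₂ ϑ
  have h1 : HasDerivAt (fun ϑ => bandFermiRadius μ (ϑ + π)) (bandFermiRadiusDeriv μ (θ + π)) θ :=
    (hasDerivAt_bandFermiRadius hμ₁ hμ₂ (θ + π)).comp_add_const θ π
  rw [hfun] at h1
  exact h1.unique (hasDerivAt_bandFermiRadius hμ₁ hμ₂ θ)

/-- **`α(θ + π) = α(θ) + π`.** [folklore] -/
theorem bandNormalAngle_add_pi (θ : ℝ) : bandNormalAngle μ (θ + π) = bandNormalAngle μ θ + π := by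
  rw [bandNormalAngle, bandNormalAngle, bandFermiRadius_add_pi hμ₁ hμ₂, bandFermiRadiusDeriv_add_pi hμ₁ hμ₂]
  ring

/-- `α(θ + jπ) = α(θ) + jπ` for every integer `j`. [folklore] -/
theorem bandNormalAngle_add_int_mul_pi (θ : ℝ) (j : ℤ) :
    bandNormalAngle μ (θ + j * π) = bandNormalAngle μ θ + j * π := by
  induction j using Int.induction_on with
  | zero => simp
  | succ n ih =>
      have h := bandNormalAngle_add_pi hμ₁ hμ₂ (θ + n * π)
      push_cast at ih h ⊢
      rw [show θ + (n + 1) * π = θ + n * π + π by ring, h, ih]; ring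
  | pred n ih =>
      have h := bandNormalAngle_add_pi hμ₁ hμ₂ (θ + (-(n : ℝ) - 1) * π)
      push_cast at ih h ⊢
      rw [show θ + (-(n : ℝ) - 1) * π + π = θ + -(n : ℝ) * π by ring] at h
      linarith

/-! ### §4 Parallel gradients occur only at `θ + jπ` -/

/-- **If the gradients `(sin x, sin y)` at `θ` and at `φ` are parallel, then `φ = θ + jπ`** for
some integer `j` (injectivity of the Gauss map of a strictly convex curve modulo the central
symmetry). [folklore] -/
theorem exists_eq_add_int_mul_pi_of_cross_eq_zero {θ φ : ℝ}
    (h : Real.sin (bandX μ θ) * Real.sin (bandY μ φ) - Real.sin (bandY μ θ) * Real.sin (bandX μ φ) = 0) :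
    ∃ j : ℤ, φ = θ + j * π := by
  obtain ⟨ρ₁, hρ₁, hx₁, hy₁⟩ := sin_bandXY_eq_polar hμ₁ hμ₂ θ
  obtain ⟨ρ₂, hρ₂, hx₂, hy₂⟩ := sin_bandXY_eq_polar hμ₁ hμ₂ φ
  rw [hx₁, hy₁, hx₂, hy₂] at h
  have hsin : Real.sin (bandNormalAngle μ φ - bandNormalAngle μ θ) = 0 := by
    rw [Real.sin_sub]
    have : ρ₁ * ρ₂ * (Real.sin (bandNormalAngle μ φ) * Real.cos (bandNormalAngle μ θ) -
        Real.cos (bandNormalAngle μ φ) * Real.sin (bandNormalAngle μ θ)) = 0 := by linear_combination h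
    rcases mul_eq_zero.1 this with h0 | h0
    · exact absurd h0 (mul_pos hρ₁ hρ₂).ne'
    · exact h0
  obtain ⟨j, hj⟩ := Real.sin_eq_zero_iff.1 hsin
  refine ⟨j, ?_⟩
  have hα : bandNormalAngle μ φ = bandNormalAngle μ (θ + j * π) := by
    rw [bandNormalAngle_add_int_mul_pi hμ₁ hμ₂]; linarith
  exact (strictMono_bandNormalAngle hμ₁ hμ₂).injective hα

end Band

end Literature.MathematicalPhysics.QuantumLattice

end
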